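import Summits.QuantumFields.BalabanUV.T4Continuum.Support.NE7InterpolationLiftCurl
import HarnessLib

/-!
# NE7HomogeneousLiftFlat — THE HOMOGENEOUS SMOOTH LIFT `hlift M φ := ilift M φ + smoothLift M (φ − σφ)`: EXACT under the straight-line block average and with curl energy controlled by the
# coarse GRADIENT energy: `linQ_M (hlift M φ) (M•y) κ = φ y κ`, `Σ_{p ∈ perWin (M·N)} nhsNormSq (curl_1 (hlift M φ) p) ≤ homC d·(M^d∕M⁴)·Σ_{z ∈ periodBox N} Σ_μ Σ_ν nhsNormSq (φ(z+e_μ) ν − φ z ν)`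

Lineage `b2b-balaban-t4-ne7b-p1` (row NE7b OWNER; junction service for row NE7), generation 160; item (U) of `t4/b2b-balaban-t4-ne7-p1-g116/ROAD-G116.md` §6, homogeneous half, file 3.
The interpolation lift `ilift` of ✓ `NE7InterpolationLiftFlat` reproduces under `linQ_M` the forward convex stencil `σφ (y, κ) = Σ_{T ⊆ univ∖{κ}} w_T • φ (y + 𝟙_T) κ` (✓ `linQ_interpLift`,
`Σ w_T = 1`); the DEFECT `φ − σφ = Σ_T w_T • (φ(y) − φ(y + 𝟙_T))` is a convex combination of DIAGONAL DIFFERENCES of the datum, hence `O(∇φ)` site by site, and row NE3's smooth lift of the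
defect (✓ `NE3SmoothLiftFlat.linQ_smoothLift`: exact; ✓ `NE7SmoothRightInverseLevelQ.sum_nhsNormSq_curl_smoothLift_le`: curl letter by the MASS of its datum) restores exactness at a curl
cost `O(M^{d−4})·Σ nhsNormSq (φ − σφ) = O(M^{d−4})·Σ nhsNormSq (∇φ)`.  Everything written out (no `def`): `hlift M φ (z, κ) = (a_M·lprof M (res_κ z)) • interp M (univ∖{κ}) (φ(·,κ)) z
+ smoothLift M (φ − σφ) z κ`, `a_M = 12M∕((M−1)(M+1)(M+2))`, `w_T = M^{1−d}((M−1)∕2)^{|T|}((M+1)∕2)^{d−1−|T|}`.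
WHAT ([folklore]; 0 def, 0 sorry; every `d ≥ 1`, `M ≥ 2`, `N ≥ 1`): §1 the defect: `defect_eq_sum_smul_sub`, `nhsNormSq_sub_indic_le` (diagonal telescoping: `nhsNormSq (φ(y+𝟙_T) − φ y) ≤
2^{|T|}·|T|·OSC(y)`), `nhsNormSq_defect_le`, **`sum_nhsNormSq_defect_le`** (`Σ_y Σ_κ nhsNormSq (φ − σφ) ≤ d·2^{4d}·Σ_y Σ_μ Σ_ν nhsNormSq (φ(y+e_μ) ν − φ y ν)`); §2 `linQ_add'`,
**`linQ_homogeneousLift`** (exactness), `isSkewDir_homogeneousLift`, `homogeneousLift_add_period`; §3 **`sum_nhsNormSq_curl_homogeneousLift_le`** (the display, with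
`homC d = 2·(2304·4^d + 4d·(24·8^{d−1})²·d·2^{4d})`).
HONEST FRAMING: flat lattice kinematics of OUR lift; nothing of Bałaban's asserted; NOT NE7∕NE3 as spine nodes; row NE7b NOT touched; spine 0∕9; finite T⁴ rung (B)+1 — NOT infinite
volume, NOT mass gap, NOT BetaPertH, NOT Clay.
-/

set_option autoImplicit false

open scoped BigOperators Matrix Matrix.Norms.L2Operator
open Finset

namespace Summit.QuantumFields.BalabanUV.T4Continuum.NE7HomogeneousLiftFlat

open Literature.MathematicalPhysics.QuantumFieldTheory.Balaban1983to89
open B7Prop1Explicit B7Prop2Explicit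
open B7Prop3Flat (linQ)
open B7Prop4Flat (linQ_eq_sum)
open T4AveragingDeficitWall (curl curlAt IsSkewDir)
open T4AveragingDeficitWallBoundary (periodBox mem_periodBox card_periodBox sum_periodBox_shift)
open MinimalActionLevels (perWin)
open MatrixNorms (nhsNormSq nhsNormSq_nonneg)
open AveragingDeficitHSInner (nhsNormSq_smul)
open SmoothRefineBlocks (blk res)
open SmoothRefineInterp (interp indic indic_insert)
open NE3SmoothLiftProfile (lprof)
open NE3SmoothLiftFlat (smoothLift linQ_smoothLift)
open NE3SmoothRightInverseCurl (curlAt_flat_add)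
open NE3SmoothRightInverseBounds (smoothLift_add_period)
open NE3CovariantLineSumCore (nhsNormSq_sum_le_card_mul nhsNormSq_add_le)
open NE7SmoothRightInverseLevelQ (isSkewDir_smoothLift nhsNormSq_sub_le_two sum_nhsNormSq_curl_smoothLift_le)
open NE7InterpolationLiftFlat (linQ_interpLift interpWeight_nonneg sum_interpWeight)
open NE7InterpolationLiftCurl (isSkewDir_interpLift interpLift_add_period sum_periodBox_sum_indic sum_nhsNormSq_curl_interpLift_le)

noncomputable section

variable {d : ℕ} {n : Type} [Fintype n] [DecidableEq n]

/-! ## §1 The stencil defect `φ − σφ` is a convex combination of diagonal differences -/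

omit [Fintype n] [DecidableEq n] in
/-- The defect as a convex combination of diagonal differences: `φ y κ − Σ_T w_T • φ (y + 𝟙_T) κ = Σ_T w_T • (φ y κ − φ (y + 𝟙_T) κ)` (`Σ_T w_T = 1`, `M ≥ 1`). [folklore] -/
theorem defect_eq_sum_smul_sub {M : ℕ} (hM : 1 ≤ M) (φ : Site d → Fin d → Matrix n n ℂ) (y : Site d) (κ : Fin d) :
    φ y κ - ∑ T ∈ (Finset.univ.erase κ).powerset,
        ((((M : ℝ)) ^ (d - 1))⁻¹ * ((((M : ℝ)) - 1) / 2) ^ T.card * ((((M : ℝ)) + 1) / 2) ^ ((d - 1) - T.card)) • φ (y + indic T) κ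
      = ∑ T ∈ (Finset.univ.erase κ).powerset,
        ((((M : ℝ)) ^ (d - 1))⁻¹ * ((((M : ℝ)) - 1) / 2) ^ T.card * ((((M : ℝ)) + 1) / 2) ^ ((d - 1) - T.card)) • (φ y κ - φ (y + indic T) κ) := by
  simp only [smul_sub, Finset.sum_sub_distrib, ← Finset.sum_smul, sum_interpWeight hM κ, one_smul]

omit [DecidableEq n] in
/-- `nhsNormSq (−X) = nhsNormSq X`. [folklore] -/
theorem nhsNormSq_neg' (X : Matrix n n ℂ) : nhsNormSq (-X) = nhsNormSq X := by
  unfold MatrixNorms.nhsNormSq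
  congr 1
  exact Finset.sum_congr rfl fun a _ => Finset.sum_congr rfl fun b _ => by rw [Matrix.neg_apply, norm_neg]

/-- **DIAGONAL TELESCOPING**: `nhsNormSq (φ (y + 𝟙_T) κ − φ y κ) ≤ 2^{|T|}·|T|·Σ_{T' ⊆ univ} Σ_i nhsNormSq (φ (y + 𝟙_{T'} + e_i) κ − φ (y + 𝟙_{T'}) κ)`. [folklore] -/
theorem nhsNormSq_sub_indic_le [Nonempty n] (φ : Site d → Fin d → Matrix n n ℂ) (y : Site d) (κ : Fin d) (T : Finset (Fin d)) :
    nhsNormSq (φ (y + indic T) κ - φ y κ)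
      ≤ 2 ^ T.card * T.card * ∑ T' ∈ (Finset.univ : Finset (Fin d)).powerset, ∑ i : Fin d, nhsNormSq (φ (y + indic T' + e i) κ - φ (y + indic T') κ) := by
  set OSC := ∑ T' ∈ (Finset.univ : Finset (Fin d)).powerset, ∑ i : Fin d, nhsNormSq (φ (y + indic T' + e i) κ - φ (y + indic T') κ) with hOSC
  have hOSC0 : 0 ≤ OSC := Finset.sum_nonneg fun T' _ => Finset.sum_nonneg fun i _ => nhsNormSq_nonneg _
  have hstep : ∀ (T' : Finset (Fin d)) (i : Fin d), nhsNormSq (φ (y + indic T' + e i) κ - φ (y + indic T') κ) ≤ OSC := by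
    intro T' i
    rw [hOSC]
    refine le_trans ?_ (Finset.single_le_sum (f := fun T'' => ∑ i' : Fin d, nhsNormSq (φ (y + indic T'' + e i') κ - φ (y + indic T'') κ))
      (fun T'' _ => Finset.sum_nonneg fun i' _ => nhsNormSq_nonneg _) (Finset.mem_powerset.mpr (Finset.subset_univ T')))
    exact Finset.single_le_sum (f := fun i' => nhsNormSq (φ (y + indic T' + e i') κ - φ (y + indic T') κ)) (fun i' _ => nhsNormSq_nonneg _) (Finset.mem_univ i)
  induction T using Finset.induction_on with
  | empty => simp [nhsNormSq]
  | insert i T hi ih =>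
      rw [indic_insert hi, Finset.card_insert_of_notMem hi, show y + (e i + indic T) = y + indic T + e i by abel]
      have hsplit : φ (y + indic T + e i) κ - φ y κ = (φ (y + indic T + e i) κ - φ (y + indic T) κ) + (φ (y + indic T) κ - φ y κ) := by abel
      rw [hsplit]
      have hpow : (2 : ℝ) ^ T.card ≥ 1 := one_le_pow₀ (by norm_num)
      calc nhsNormSq ((φ (y + indic T + e i) κ - φ (y + indic T) κ) + (φ (y + indic T) κ - φ y κ))
          ≤ 2 * (nhsNormSq (φ (y + indic T + e i) κ - φ (y + indic T) κ) + nhsNormSq (φ (y + indic T) κ - φ y κ)) := nhsNormSq_add_le _ _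
        _ ≤ 2 * (OSC + 2 ^ T.card * T.card * OSC) := by nlinarith [hstep T i, ih]
        _ ≤ 2 ^ (T.card + 1) * ((T.card + 1 : ℕ) : ℝ) * OSC := by
            rw [pow_succ]; push_cast; nlinarith

/-- **THE DEFECT IS `O(∇φ)` SITE BY SITE**: `nhsNormSq (φ y κ − σφ (y, κ)) ≤ d·2^{3d}·Σ_{T' ⊆ univ} Σ_i nhsNormSq (φ (y + 𝟙_{T'} + e_i) κ − φ (y + 𝟙_{T'}) κ)` (`M ≥ 1`). [folklore] -/
theorem nhsNormSq_defect_le [Nonempty n] {M : ℕ} (hM : 1 ≤ M) (φ : Site d → Fin d → Matrix n n ℂ) (y : Site d) (κ : Fin d) :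
    nhsNormSq (φ y κ - ∑ T ∈ (Finset.univ.erase κ).powerset,
        ((((M : ℝ)) ^ (d - 1))⁻¹ * ((((M : ℝ)) - 1) / 2) ^ T.card * ((((M : ℝ)) + 1) / 2) ^ ((d - 1) - T.card)) • φ (y + indic T) κ)
      ≤ (d : ℝ) * 2 ^ (3 * d) * ∑ T' ∈ (Finset.univ : Finset (Fin d)).powerset, ∑ i : Fin d, nhsNormSq (φ (y + indic T' + e i) κ - φ (y + indic T') κ) := by
  set OSC := ∑ T' ∈ (Finset.univ : Finset (Fin d)).powerset, ∑ i : Fin d, nhsNormSq (φ (y + indic T' + e i) κ - φ (y + indic T') κ) with hOSC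
  have hOSC0 : 0 ≤ OSC := Finset.sum_nonneg fun T' _ => Finset.sum_nonneg fun i _ => nhsNormSq_nonneg _
  rw [defect_eq_sum_smul_sub hM]
  refine (nhsNormSq_sum_le_card_mul _ _).trans ?_
  have hcardS : ((Finset.univ.erase κ).powerset.card : ℝ) ≤ 2 ^ d := by
    rw [Finset.card_powerset, Finset.card_erase_of_mem (Finset.mem_univ κ), Finset.card_univ, Fintype.card_fin]
    exact_mod_cast Nat.pow_le_pow_right (by norm_num) (Nat.sub_le d 1)
  -- each term: `w_T² · nhs ≤ nhs ≤ 2^{|T|}|T|·OSC ≤ 2^d·d·OSC`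
  have hterm : ∀ T ∈ (Finset.univ.erase κ).powerset,
      nhsNormSq (((((M : ℝ)) ^ (d - 1))⁻¹ * ((((M : ℝ)) - 1) / 2) ^ T.card * ((((M : ℝ)) + 1) / 2) ^ ((d - 1) - T.card)) • (φ y κ - φ (y + indic T) κ))
        ≤ 2 ^ d * d * OSC := by
    intro T hT
    have hw0 := interpWeight_nonneg (d := d) hM T
    have hw1 : (((M : ℝ)) ^ (d - 1))⁻¹ * ((((M : ℝ)) - 1) / 2) ^ T.card * ((((M : ℝ)) + 1) / 2) ^ ((d - 1) - T.card) ≤ 1 :=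
      calc _ ≤ ∑ T' ∈ (Finset.univ.erase κ).powerset, (((M : ℝ)) ^ (d - 1))⁻¹ * ((((M : ℝ)) - 1) / 2) ^ T'.card * ((((M : ℝ)) + 1) / 2) ^ ((d - 1) - T'.card) :=
            Finset.single_le_sum (fun T' _ => interpWeight_nonneg (d := d) hM T') hT
        _ = 1 := sum_interpWeight (d := d) hM κ
    rw [nhsNormSq_smul]
    have hTd : T.card ≤ d := (Finset.card_le_univ _).trans (by rw [Fintype.card_fin])
    have hneg : nhsNormSq (φ y κ - φ (y + indic T) κ) = nhsNormSq (φ (y + indic T) κ - φ y κ) := by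
      rw [← neg_sub, nhsNormSq_neg']
    rw [hneg]
    calc _ ≤ 1 * nhsNormSq (φ (y + indic T) κ - φ y κ) := mul_le_mul_of_nonneg_right (by nlinarith) (nhsNormSq_nonneg _)
      _ ≤ 2 ^ T.card * T.card * OSC := by rw [one_mul]; exact nhsNormSq_sub_indic_le φ y κ T
      _ ≤ 2 ^ d * d * OSC := by
          refine mul_le_mul_of_nonneg_right (mul_le_mul (pow_le_pow_right₀ (by norm_num) hTd) (by exact_mod_cast hTd) (Nat.cast_nonneg _) (by positivity)) hOSC0
  calc _ ≤ ((Finset.univ.erase κ).powerset.card : ℝ) * ∑ T ∈ (Finset.univ.erase κ).powerset, 2 ^ d * d * OSC :=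
        mul_le_mul_of_nonneg_left (Finset.sum_le_sum hterm) (Nat.cast_nonneg _)
    _ = ((Finset.univ.erase κ).powerset.card : ℝ) * ((Finset.univ.erase κ).powerset.card : ℝ) * (2 ^ d * d * OSC) := by
        rw [Finset.sum_const, nsmul_eq_mul]; ring
    _ ≤ 2 ^ d * 2 ^ d * (2 ^ d * d * OSC) := mul_le_mul_of_nonneg_right (mul_le_mul hcardS hcardS (Nat.cast_nonneg _) (by positivity)) (by positivity)
    _ = (d : ℝ) * 2 ^ (3 * d) * OSC := by ring

/-- **THE ℓ² MASS OF THE DEFECT IS CONTROLLED BY THE GRADIENT ENERGY** (`M ≥ 1`, `N ≥ 1`, `φ` `N`-periodic):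
`Σ_{y ∈ periodBox N} Σ_κ nhsNormSq (φ y κ − σφ (y,κ)) ≤ d·2^{4d}·Σ_{y ∈ periodBox N} Σ_μ Σ_ν nhsNormSq (φ (y + e_μ) ν − φ y ν)`. [folklore] -/
theorem sum_nhsNormSq_defect_le [Nonempty n] {M : ℕ} (hM : 1 ≤ M) {N : ℕ} (hN : 1 ≤ N) {φ : Site d → Fin d → Matrix n n ℂ}
    (hφ : ∀ (z : Site d) (τ κ : Fin d), φ (z + (N : ℤ) • e τ) κ = φ z κ) :
    ∑ y ∈ periodBox (d := d) N, ∑ κ : Fin d, nhsNormSq (φ y κ - ∑ T ∈ (Finset.univ.erase κ).powerset,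
        ((((M : ℝ)) ^ (d - 1))⁻¹ * ((((M : ℝ)) - 1) / 2) ^ T.card * ((((M : ℝ)) + 1) / 2) ^ ((d - 1) - T.card)) • φ (y + indic T) κ)
      ≤ (d : ℝ) * 2 ^ (4 * d) * ∑ y ∈ periodBox (d := d) N, ∑ μ : Fin d, ∑ ν : Fin d, nhsNormSq (φ (y + e μ) ν - φ y ν) := by
  have hper : ∀ (x : Site d) (τ : Fin d), (∑ κ : Fin d, ∑ i : Fin d, nhsNormSq (φ (x + (N : ℤ) • e τ + e i) κ - φ (x + (N : ℤ) • e τ) κ))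
      = ∑ κ : Fin d, ∑ i : Fin d, nhsNormSq (φ (x + e i) κ - φ x κ) := by
    intro x τ
    refine Finset.sum_congr rfl fun κ _ => Finset.sum_congr rfl fun i _ => ?_
    rw [add_right_comm, hφ, hφ]
  calc _ ≤ ∑ y ∈ periodBox (d := d) N, ∑ κ : Fin d, ((d : ℝ) * 2 ^ (3 * d) *
          ∑ T' ∈ (Finset.univ : Finset (Fin d)).powerset, ∑ i : Fin d, nhsNormSq (φ (y + indic T' + e i) κ - φ (y + indic T') κ)) :=
        Finset.sum_le_sum fun y _ => Finset.sum_le_sum fun κ _ => nhsNormSq_defect_le hM φ y κ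
    _ = (d : ℝ) * 2 ^ (3 * d) * ∑ y ∈ periodBox (d := d) N, ∑ T' ∈ (Finset.univ : Finset (Fin d)).powerset,
          (∑ κ : Fin d, ∑ i : Fin d, nhsNormSq (φ (y + indic T' + e i) κ - φ (y + indic T') κ)) := by
        rw [Finset.mul_sum]
        refine Finset.sum_congr rfl fun y _ => ?_
        rw [← Finset.mul_sum, Finset.sum_comm]
    _ = (d : ℝ) * 2 ^ (3 * d) * (2 ^ d * ∑ y ∈ periodBox (d := d) N, ∑ κ : Fin d, ∑ i : Fin d, nhsNormSq (φ (y + e i) κ - φ y κ)) := by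
        rw [sum_periodBox_sum_indic hN (g := fun y => ∑ κ : Fin d, ∑ i : Fin d, nhsNormSq (φ (y + e i) κ - φ y κ)) hper]
    _ = (d : ℝ) * 2 ^ (4 * d) * ∑ y ∈ periodBox (d := d) N, ∑ μ : Fin d, ∑ ν : Fin d, nhsNormSq (φ (y + e μ) ν - φ y ν) := by
        rw [Finset.sum_congr rfl fun y _ => (Finset.sum_comm : ∑ κ : Fin d, ∑ i : Fin d, nhsNormSq (φ (y + e i) κ - φ y κ) = _)]
        ring

/-! ## §2 The homogeneous lift: exact, skew, periodic -/

/-- Additivity of the straight-line block average. [folklore] -/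
theorem linQ_add' (M : ℕ) (A B : Site d → Fin d → Matrix n n ℂ) (q : Site d) (κ : Fin d) : linQ M (A + B) q κ = linQ M A q κ + linQ M B q κ := by
  have h := B7Prop4Flat.linQ_sub M (A + B) B q κ
  rw [add_sub_cancel_right] at h
  rw [h, sub_add_cancel]

/-- **EXACTNESS OF THE HOMOGENEOUS LIFT**: `linQ M (ilift M φ + smoothLift M (φ − σφ)) (M•y) κ = φ y κ` (`M ≥ 2`). [folklore] -/
theorem linQ_homogeneousLift {M : ℕ} (hM : 2 ≤ M) (φ : Site d → Fin d → Matrix n n ℂ) (y : Site d) (κ : Fin d) :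
    linQ M ((fun z κ' => ((12 * (M : ℝ) / ((((M : ℝ)) - 1) * ((M : ℝ) + 1) * ((M : ℝ) + 2))) * lprof M (res M z κ'))
          • interp M (Finset.univ.erase κ') (fun w => φ w κ') z)
        + smoothLift M (fun y' κ'' => φ y' κ'' - ∑ T ∈ (Finset.univ.erase κ'').powerset,
            ((((M : ℝ)) ^ (d - 1))⁻¹ * ((((M : ℝ)) - 1) / 2) ^ T.card * ((((M : ℝ)) + 1) / 2) ^ ((d - 1) - T.card)) • φ (y' + indic T) κ''))
        ((M : ℤ) • y) κ = φ y κ := by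
  rw [linQ_add', linQ_interpLift hM, linQ_smoothLift hM]
  abel

omit [Fintype n] [DecidableEq n] in
/-- The homogeneous lift of a skew coarse field is skew. [folklore] -/
theorem isSkewDir_homogeneousLift (M : ℕ) {φ : Site d → Fin d → Matrix n n ℂ} (hφ : IsSkewDir φ) :
    IsSkewDir ((fun z κ' => ((12 * (M : ℝ) / ((((M : ℝ)) - 1) * ((M : ℝ) + 1) * ((M : ℝ) + 2))) * lprof M (res M z κ'))
          • interp M (Finset.univ.erase κ') (fun w => φ w κ') z)
        + smoothLift M (fun y' κ'' => φ y' κ'' - ∑ T ∈ (Finset.univ.erase κ'').powerset,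
            ((((M : ℝ)) ^ (d - 1))⁻¹ * ((((M : ℝ)) - 1) / 2) ^ T.card * ((((M : ℝ)) + 1) / 2) ^ ((d - 1) - T.card)) • φ (y' + indic T) κ'')) := by
  intro z κ'
  rw [Pi.add_apply, Pi.add_apply]
  refine (skewAdjoint (Matrix n n ℂ)).add_mem (isSkewDir_interpLift M hφ z κ') (isSkewDir_smoothLift M (fun y' κ'' => ?_) z κ')
  exact (skewAdjoint (Matrix n n ℂ)).sub_mem (hφ _ _) ((skewAdjoint (Matrix n n ℂ)).sum_mem fun T _ => skewAdjoint.smul_mem _ (hφ _ _))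

omit [Fintype n] [DecidableEq n] in
/-- The defect of an `N`-periodic coarse field is `N`-periodic. [folklore] -/
theorem defect_add_period {M N : ℕ} {φ : Site d → Fin d → Matrix n n ℂ} (hφ : ∀ (z : Site d) (τ κ : Fin d), φ (z + (N : ℤ) • e τ) κ = φ z κ)
    (z : Site d) (τ κ : Fin d) :
    (fun y' κ'' => φ y' κ'' - ∑ T ∈ (Finset.univ.erase κ'').powerset,
        ((((M : ℝ)) ^ (d - 1))⁻¹ * ((((M : ℝ)) - 1) / 2) ^ T.card * ((((M : ℝ)) + 1) / 2) ^ ((d - 1) - T.card)) • φ (y' + indic T) κ'') (z + (N : ℤ) • e τ) κ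
      = (fun y' κ'' => φ y' κ'' - ∑ T ∈ (Finset.univ.erase κ'').powerset,
        ((((M : ℝ)) ^ (d - 1))⁻¹ * ((((M : ℝ)) - 1) / 2) ^ T.card * ((((M : ℝ)) + 1) / 2) ^ ((d - 1) - T.card)) • φ (y' + indic T) κ'') z κ := by
  simp only [hφ, add_right_comm z ((N : ℤ) • e τ)]

omit [Fintype n] [DecidableEq n] in
/-- The homogeneous lift of an `N`-periodic coarse field is `(M·N)`-periodic (`M ≥ 1`). [folklore] -/
theorem homogeneousLift_add_period {M : ℕ} (hM : 1 ≤ M) {N : ℕ} {φ : Site d → Fin d → Matrix n n ℂ}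
    (hφ : ∀ (z : Site d) (τ κ : Fin d), φ (z + (N : ℤ) • e τ) κ = φ z κ) (x : Site d) (τ κ : Fin d) :
    ((fun z κ' => ((12 * (M : ℝ) / ((((M : ℝ)) - 1) * ((M : ℝ) + 1) * ((M : ℝ) + 2))) * lprof M (res M z κ'))
          • interp M (Finset.univ.erase κ') (fun w => φ w κ') z)
        + smoothLift M (fun y' κ'' => φ y' κ'' - ∑ T ∈ (Finset.univ.erase κ'').powerset,
            ((((M : ℝ)) ^ (d - 1))⁻¹ * ((((M : ℝ)) - 1) / 2) ^ T.card * ((((M : ℝ)) + 1) / 2) ^ ((d - 1) - T.card)) • φ (y' + indic T) κ''))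
        (x + ((M * N : ℕ) : ℤ) • e τ) κ
      = ((fun z κ' => ((12 * (M : ℝ) / ((((M : ℝ)) - 1) * ((M : ℝ) + 1) * ((M : ℝ) + 2))) * lprof M (res M z κ'))
          • interp M (Finset.univ.erase κ') (fun w => φ w κ') z)
        + smoothLift M (fun y' κ'' => φ y' κ'' - ∑ T ∈ (Finset.univ.erase κ'').powerset,
            ((((M : ℝ)) ^ (d - 1))⁻¹ * ((((M : ℝ)) - 1) / 2) ^ T.card * ((((M : ℝ)) + 1) / 2) ^ ((d - 1) - T.card)) • φ (y' + indic T) κ'')) x κ := by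
  have h1 := interpLift_add_period hM hφ x τ κ
  have h2 := smoothLift_add_period hM (N := N) (φ := fun y' κ'' => φ y' κ'' - ∑ T ∈ (Finset.univ.erase κ'').powerset,
    ((((M : ℝ)) ^ (d - 1))⁻¹ * ((((M : ℝ)) - 1) / 2) ^ T.card * ((((M : ℝ)) + 1) / 2) ^ ((d - 1) - T.card)) • φ (y' + indic T) κ'')
    (fun z τ' κ' => defect_add_period (M := M) hφ z τ' κ') x τ κ
  simp only [Pi.add_apply] at h1 h2 ⊢
  rw [h1, h2]

/-! ## §3 The curl energy of the homogeneous lift -/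

/-- **THE HOMOGENEOUS CURL LETTER** (`M ≥ 2`, `N ≥ 1`, `φ` `N`-periodic): `Σ_{p ∈ perWin (M·N)} nhsNormSq (curl_1 (hlift M φ) p)
≤ 2·(2304·4^d + 4d·(24·8^{d−1})²·(d·2^{4d}))·(M^d∕M⁴)·Σ_{z ∈ periodBox N} Σ_μ Σ_ν nhsNormSq (φ (z + e_μ) ν − φ z ν)` — the GRADIENT energy of the datum; `M^{d−4} = 1` at `d = 4`. [folklore] -/
theorem sum_nhsNormSq_curl_homogeneousLift_le [Nonempty n] {M : ℕ} (hM : 2 ≤ M) (hd : 1 ≤ d) {N : ℕ} (hN : 1 ≤ N) {φ : Site d → Fin d → Matrix n n ℂ}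
    (hφ : ∀ (z : Site d) (τ κ : Fin d), φ (z + (N : ℤ) • e τ) κ = φ z κ) :
    ∑ p ∈ perWin d (M * N), nhsNormSq (curl (BlockAveragePushDirSplit.flat (d := d) (n := n))
        ((fun z κ' => ((12 * (M : ℝ) / ((((M : ℝ)) - 1) * ((M : ℝ) + 1) * ((M : ℝ) + 2))) * lprof M (res M z κ'))
            • interp M (Finset.univ.erase κ') (fun w => φ w κ') z)
          + smoothLift M (fun y' κ'' => φ y' κ'' - ∑ T ∈ (Finset.univ.erase κ'').powerset,
              ((((M : ℝ)) ^ (d - 1))⁻¹ * ((((M : ℝ)) - 1) / 2) ^ T.card * ((((M : ℝ)) + 1) / 2) ^ ((d - 1) - T.card)) • φ (y' + indic T) κ'')) p)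
      ≤ 2 * (2304 * 4 ^ d + 4 * (d : ℝ) * (24 * (8 : ℝ) ^ (d - 1)) ^ 2 * ((d : ℝ) * 2 ^ (4 * d))) * ((M : ℝ) ^ d / (M : ℝ) ^ 4)
          * ∑ z ∈ periodBox (d := d) N, ∑ μ : Fin d, ∑ ν : Fin d, nhsNormSq (φ (z + e μ) ν - φ z ν) := by
  have hM1 : 1 ≤ M := by omega
  set il : Site d → Fin d → Matrix n n ℂ := fun z κ' => ((12 * (M : ℝ) / ((((M : ℝ)) - 1) * ((M : ℝ) + 1) * ((M : ℝ) + 2))) * lprof M (res M z κ'))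
    • interp M (Finset.univ.erase κ') (fun w => φ w κ') z with hil
  set e' : Site d → Fin d → Matrix n n ℂ := fun y' κ'' => φ y' κ'' - ∑ T ∈ (Finset.univ.erase κ'').powerset,
    ((((M : ℝ)) ^ (d - 1))⁻¹ * ((((M : ℝ)) - 1) / 2) ^ T.card * ((((M : ℝ)) + 1) / 2) ^ ((d - 1) - T.card)) • φ (y' + indic T) κ'' with he'
  set G := ∑ z ∈ periodBox (d := d) N, ∑ μ : Fin d, ∑ ν : Fin d, nhsNormSq (φ (z + e μ) ν - φ z ν) with hG
  have hG0 : 0 ≤ G := Finset.sum_nonneg fun z _ => Finset.sum_nonneg fun μ _ => Finset.sum_nonneg fun ν _ => nhsNormSq_nonneg _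
  have hratio : 0 ≤ (M : ℝ) ^ d / (M : ℝ) ^ 4 := by positivity
  -- split the curl and use `nhsNormSq (a + b) ≤ 2 (nhsNormSq a + nhsNormSq b)`
  have hsplit : ∀ p ∈ perWin d (M * N), nhsNormSq (curl (BlockAveragePushDirSplit.flat (d := d) (n := n)) (il + smoothLift M e') p)
      ≤ 2 * (nhsNormSq (curl (BlockAveragePushDirSplit.flat (d := d) (n := n)) il p) + nhsNormSq (curl (BlockAveragePushDirSplit.flat (d := d) (n := n)) (smoothLift M e') p)) := by
    intro p _
    unfold curl
    rw [curlAt_flat_add]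
    have h := nhsNormSq_sub_le_two (curlAt (BlockAveragePushDirSplit.flat (d := d) (n := n)) il p.1 p.2.1.1 p.2.1.2)
      (-curlAt (BlockAveragePushDirSplit.flat (d := d) (n := n)) (smoothLift M e') p.1 p.2.1.1 p.2.1.2)
    rw [sub_neg_eq_add] at h
    refine h.trans (le_of_eq ?_)
    congr 2
    unfold MatrixNorms.nhsNormSq
    congr 1
    exact Finset.sum_congr rfl fun a _ => Finset.sum_congr rfl fun b _ => by rw [Matrix.neg_apply, norm_neg]
  have h1 := sum_nhsNormSq_curl_interpLift_le (n := n) hM hN hφ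
  have h2 := sum_nhsNormSq_curl_smoothLift_le (n := n) hM hd N e'
  have h3 := sum_nhsNormSq_defect_le (n := n) (M := M) hM1 hN hφ
  calc _ ≤ ∑ p ∈ perWin d (M * N), 2 * (nhsNormSq (curl (BlockAveragePushDirSplit.flat (d := d) (n := n)) il p)
          + nhsNormSq (curl (BlockAveragePushDirSplit.flat (d := d) (n := n)) (smoothLift M e') p)) := Finset.sum_le_sum hsplit
    _ = 2 * (∑ p ∈ perWin d (M * N), nhsNormSq (curl (BlockAveragePushDirSplit.flat (d := d) (n := n)) il p)
          + ∑ p ∈ perWin d (M * N), nhsNormSq (curl (BlockAveragePushDirSplit.flat (d := d) (n := n)) (smoothLift M e') p)) := by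
        rw [← Finset.mul_sum, Finset.sum_add_distrib]
    _ ≤ 2 * (2304 * 4 ^ d * ((M : ℝ) ^ d / (M : ℝ) ^ 4) * G
          + 4 * (d : ℝ) * (24 * (8 : ℝ) ^ (d - 1)) ^ 2 * ((M : ℝ) ^ d / (M : ℝ) ^ 4) * ((d : ℝ) * 2 ^ (4 * d) * G)) := by
        refine mul_le_mul_of_nonneg_left (add_le_add h1 (h2.trans ?_)) (by norm_num)
        exact mul_le_mul_of_nonneg_left h3 (by positivity)
    _ = _ := by ring

end

end Summit.QuantumFields.BalabanUV.T4Continuum.NE7HomogeneousLiftFlat
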